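import Summits.HodgeConjecture.HodgeConjecture.Theorems.F0D6CmCurveBodyASockets   -- ★ previous part of the same Lines workfile `D6CmCurveBodyA` (size-lint split ×5)
import HarnessLib

/-!
# `F0D6CmCurveBodyA` — ★ RE-HOME of `Lines/D6CmCurveBodyA.lean`, PART 5 of 5 (size-lint split; cut at a top-level declaration boundary).

See PART 1 `Theorems/F0D6CmCurveBodyAGlue.lean` for the full re-home header and the original module docstring (verbatim there). Namespaces KEPT
(re-opened below exactly as they stand at the cut, with their `open` lines); code bytes = the workfile՚s, docstrings included; options preamble repeated from PART 1.
HC_CM is proved only modulo the 7 printed citations (2 remaining: hLiu418 = stmt-HodgeConjecture-24832, h413 = stmt-HodgeConjecture-24833) until rung 0 closes; a re-home is count-neutral. -/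

noncomputable section

open scoped TensorProduct NumberField
open NumberField IsDedekindDomain Filter
open Literature.NumberTheory.GaloisRepresentations
open Literature.NumberTheory.Automorphic
open Literature.NumberTheory.Automorphic.Liu2021.AppendixC
open scoped TensorProduct Matrix NumberField Kronecker ComplexOrder
open NumberField NumberField.InfinitePlace IsDedekindDomain
open Summit.HodgeConjecture.CorCM.Model Summit.HodgeConjecture.CorCM.Model.HComp Summit.HodgeConjecture.CorCM.HComp
open Literature.AlgebraicGeometry.Motives (CMType)
open Literature.AlgebraicGeometry.ShimuraVarieties.UnitaryCanonicalModel
open Literature.NumberTheory.Automorphic Literature.NumberTheory.Automorphic.UnitaryGroup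
open Literature.NumberTheory.Automorphic.IdeleClassGroup Literature.NumberTheory.Automorphic.Liu2021 Literature.NumberTheory.Automorphic.Liu2021.AppendixC
open Literature.NumberTheory.GaloisRepresentations Literature.RepresentationTheory.Liu2021 Literature.RepresentationTheory.HarrisKudlaSweet1996
open Literature.AlgebraicGeometry.Liu2021 (IsAdmissibleElement)
open Literature.NumberTheory.Weil1964 Literature.NumberTheory.GelbartRogawski1991 Literature.NumberTheory.GelbartRogawski1991.UnitaryDualPair Literature.NumberTheory.GelbartRogawski1991.UnitaryDualPair.WeilCoinv
open Literature.NumberTheory.GelbartRogawski1991.UnitaryDualPair.LocalSplitting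
open Literature.NumberTheory.Automorphic.Liu2021.Def411WeilCarriersDoubling
open Literature.NumberTheory.Automorphic.Liu2021.Def411WeilCarriers (TW JW JW_eq isSymm_TW isUnit_det_TW Rep Eps epsOf Chi rhoVAtLine)


/-! ## Part G — BY-PASTE of the Literature FACT draft `Liu2021/LemD1SplitPlaceHeckeEigenvalues.lean` (A-p15 (g10) HOME draft,
`A-provers/A-p15/g10/LemD1SplitPlaceHeckeEigenvalues.draft.A-p15g10.lean`) and its ONE-LINE instantiation to `S4ShapeA`.
When the fact file lands, this block is replaced by `import Literature.NumberTheory.Automorphic.Liu2021.LemD1SplitPlaceHeckeEigenvalues`. -/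

namespace Literature.NumberTheory.Automorphic.Liu2021

/-! **`complexConj_mul_complexConj'` — NOT RESTATED IN THE ★ RE-HOME (gate `dedup.landed`, A-p14 (g39) dry-run 2026-09-02T08:10:53Z):** the Lines original
restates, statement for statement, the already-landed ★ `Literature.NumberTheory.Automorphic.Liu2021.Def411WeilCarriers.complexConj_mul_complexConj'` (in the import closure, `LemD1SplitPlaceHeckeEigenvaluesJunction`);
the ★ re-home uses that declaration BY NAME at every former call site of `complexConj_mul_complexConj'`. -/

/-- **[Liu2021, Lemma D.1 (2)+(4)] at the split places, rank 2, on spherical Hecke eigenvalues** (NAMED FACT, D-0014 — the printed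
lemma, not proved here; see the module docstring for print, dictionary and conventions): for a CM field `E = L`, `μ` conjugate-symplectic,
the Weil representation `ω⋆ = ω(μᶜ-splitting, r ε, χ)` of `U(J⋆)(𝔸_{E⁺,f})` at any rational frame `g⋆` of a real diagonal `diag dJ`, and
`J⋆` hermitian invertible: off a finite set of places of `E`, at every `w` SPLIT over `w⁺` with `J⋆_w ∈ GL₂(𝒪_w)`, for every level `K`
hyperspecial-and-factorisable at `w⁺` and every `x ∈ ω⋆^K`,
`T_{w,1} x = (μ₁(ϖ_w) + μ₂(ϖ_w)) • x` and `q_w • T_{w,2} x = (μ₁(ϖ_w) μ₂(ϖ_w)) • x`, `μ₁ = μ^{alg}`, `μ₂ = (μ^{alg})^c · χ̌`.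
(print: Liu2021, App. D proof of Lemma D.1, first paragraph (l. 5241, p. 126); Lemma D.1 (2), (4) (l. 5229–5235); Thm. D.6 statement l. 5441) (print: GelbartRogawski1990, (2.6)) (print: CartierCorvallis1979, §IV.2 (4.2)) -/
def lemD1_splitPlace_heckeEigenvalues_A : Prop :=
  ∀ (L : Type) [Field L] [NumberField L] [IsCMField L]
    (μ : Literature.NumberTheory.Automorphic.IdeleClassGroup L →ₜ* Circle)
    (hμ : IdeleClassGroup.IsConjugateSymplectic L μ)
    (Jstar : Matrix (Fin 2) (Fin 2) L) (t : L) (ht : t ≠ 0) (gstar : GL (Fin 2) L)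
    (dJ : Fin 2 → L) (hdJ : ∀ i, IsCMField.complexConj L (dJ i) = dJ i) (hdJ0 : ∀ i, dJ i ≠ 0)
    (hg : formCongr ((IsCMField.complexConj L) : L →+* L) gstar (t • Jstar) = Matrix.diagonal dJ)
    (r : Rep ↥(maximalRealSubfield L) (imagUnitSq L)) (ε : Eps ↥(maximalRealSubfield L) (imagUnitSq L)) (χ : Chi ↥(maximalRealSubfield L) L (IsCMField.complexConj L))
    (hJ : (Jstar.map (IsCMField.complexConj L))ᵀ = Jstar) (hJu : IsUnit Jstar),
    ∃ S₀ : Set (HeightOneSpectrum (𝓞 L)), S₀.Finite ∧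
      ∀ w : HeightOneSpectrum (𝓞 L), w ∉ S₀ → ∀ hw : (IsCMField.complexConj L) • w ≠ w,
        (UnitaryGroup.isUnit_placeForm Jstar hJu w).unit ∈ glInt 2 (w.adicCompletion L) →
          ∀ K : Subgroup ↥(finAdelic ↥(maximalRealSubfield L) L (IsCMField.complexConj L) 2 Jstar),
            UnitaryGroup.IsHyperspecialAt ↥(maximalRealSubfield L) L (IsCMField.complexConj L) 2 Jstar K (w.under (𝓞 ↥(maximalRealSubfield L))) →
            ∀ x ∈ Representation.fixedPoints
                ((rhoVAtLine ↥(maximalRealSubfield L) L (IsCMField.complexConj L) 2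
                  (finProdFinEquiv : Fin 2 × Fin 1 ≃ Fin (2 * 1)) (Matrix.diagonal dJ)
                  (complexConj_imagUnit L) (imagUnit_ne_zero L) (imagUnit_mul_self L) (realDiagonal_isSymm L dJ hdJ)
                  (isUnit_det_realDiagonal L dJ hdJ hdJ0) (realDiagonal_map L dJ hdJ).symm
                  (fun a => isCompatible_chiSplittingLine L finProdFinEquiv dJ hdJ hdJ0
                    (toHeckeCharacter L (galConj (IsCMField.complexConj L) μ))
                    (isUnitary_toHeckeCharacter L (galConj (IsCMField.complexConj L) μ))
                    ((isOscillatorChar_toHeckeCharacter_iff (galConj (IsCMField.complexConj L) μ)).mpr hμ.galConj)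
                    (TW ↥(maximalRealSubfield L) a) (isSymm_TW ↥(maximalRealSubfield L) a) (isUnit_det_TW ↥(maximalRealSubfield L) a) (JW ↥(maximalRealSubfield L) L a) (JW_eq ↥(maximalRealSubfield L) L a))
                  (r.toFun ε) χ).comp
                  (finAdelicCongr ↥(maximalRealSubfield L) L (IsCMField.complexConj L) gstar ht hg).symm.toMonoidHom) K,
              UnitaryGroup.heckeTAt ↥(maximalRealSubfield L) L (IsCMField.complexConj L) 2 Jstar
                ((rhoVAtLine ↥(maximalRealSubfield L) L (IsCMField.complexConj L) 2
                  (finProdFinEquiv : Fin 2 × Fin 1 ≃ Fin (2 * 1)) (Matrix.diagonal dJ)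
                  (complexConj_imagUnit L) (imagUnit_ne_zero L) (imagUnit_mul_self L) (realDiagonal_isSymm L dJ hdJ)
                  (isUnit_det_realDiagonal L dJ hdJ hdJ0) (realDiagonal_map L dJ hdJ).symm
                  (fun a => isCompatible_chiSplittingLine L finProdFinEquiv dJ hdJ hdJ0
                    (toHeckeCharacter L (galConj (IsCMField.complexConj L) μ))
                    (isUnitary_toHeckeCharacter L (galConj (IsCMField.complexConj L) μ))
                    ((isOscillatorChar_toHeckeCharacter_iff (galConj (IsCMField.complexConj L) μ)).mpr hμ.galConj)
                    (TW ↥(maximalRealSubfield L) a) (isSymm_TW ↥(maximalRealSubfield L) a) (isUnit_det_TW ↥(maximalRealSubfield L) a) (JW ↥(maximalRealSubfield L) L a) (JW_eq ↥(maximalRealSubfield L) L a))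
                  (r.toFun ε) χ).comp
                  (finAdelicCongr ↥(maximalRealSubfield L) L (IsCMField.complexConj L) gstar ht hg).symm.toMonoidHom)
                K (⟨w, rfl⟩ : UnitaryGroup.PlacesOver L (w.under (𝓞 ↥(maximalRealSubfield L))))
                (IsCMField.complexConj_ne_one L) hJ hw (UnitaryGroup.isUnit_placeForm Jstar hJu w) (HeckeCharacter.uniformizer L w) 1 x =
                ((HeckeCharacter.galConj (IsCMField.complexConj L) (IdeleClassGroup.muAlg L μ)).valueAtUniformizer w +
                  (IdeleClassGroup.muAlg L μ *
                  HeckeCharacter.checkOfChi (Literature.NumberTheory.Automorphic.Liu2021.Def411WeilCarriers.complexConj_mul_complexConj' L) χ).valueAtUniformizer w) • x ∧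
              (Ideal.absNorm w.asIdeal : ℂ) •
                UnitaryGroup.heckeTAt ↥(maximalRealSubfield L) L (IsCMField.complexConj L) 2 Jstar
                ((rhoVAtLine ↥(maximalRealSubfield L) L (IsCMField.complexConj L) 2
                  (finProdFinEquiv : Fin 2 × Fin 1 ≃ Fin (2 * 1)) (Matrix.diagonal dJ)
                  (complexConj_imagUnit L) (imagUnit_ne_zero L) (imagUnit_mul_self L) (realDiagonal_isSymm L dJ hdJ)
                  (isUnit_det_realDiagonal L dJ hdJ hdJ0) (realDiagonal_map L dJ hdJ).symm
                  (fun a => isCompatible_chiSplittingLine L finProdFinEquiv dJ hdJ hdJ0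
                    (toHeckeCharacter L (galConj (IsCMField.complexConj L) μ))
                    (isUnitary_toHeckeCharacter L (galConj (IsCMField.complexConj L) μ))
                    ((isOscillatorChar_toHeckeCharacter_iff (galConj (IsCMField.complexConj L) μ)).mpr hμ.galConj)
                    (TW ↥(maximalRealSubfield L) a) (isSymm_TW ↥(maximalRealSubfield L) a) (isUnit_det_TW ↥(maximalRealSubfield L) a) (JW ↥(maximalRealSubfield L) L a) (JW_eq ↥(maximalRealSubfield L) L a))
                  (r.toFun ε) χ).comp
                  (finAdelicCongr ↥(maximalRealSubfield L) L (IsCMField.complexConj L) gstar ht hg).symm.toMonoidHom)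
                K (⟨w, rfl⟩ : UnitaryGroup.PlacesOver L (w.under (𝓞 ↥(maximalRealSubfield L))))
                (IsCMField.complexConj_ne_one L) hJ hw (UnitaryGroup.isUnit_placeForm Jstar hJu w) (HeckeCharacter.uniformizer L w) 2 x =
                ((HeckeCharacter.galConj (IsCMField.complexConj L) (IdeleClassGroup.muAlg L μ)).valueAtUniformizer w *
                  (IdeleClassGroup.muAlg L μ *
                  HeckeCharacter.checkOfChi (Literature.NumberTheory.Automorphic.Liu2021.Def411WeilCarriers.complexConj_mul_complexConj' L) χ).valueAtUniformizer w) • x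

end Literature.NumberTheory.Automorphic.Liu2021

namespace Summit.HodgeConjecture.CorCM.Lines.A3Liu418

/-- **`S4ShapeA` ⇐ the Literature-generality FACT [Liu2021, Lem. D.1 (2)+(4)]** at the registered GS binders: ONE application
(`L := F`, the CM field of the face; `sChiGS`/`hsChiGS` unfold to ★ `chiSplittingLine`/`isCompatible_chiSplittingLine` by `rfl`/proof
irrelevance; the weight-one and admissibility binders of the registry are simply not used by the fact). -/
theorem s4ShapeA_of_lemD1A (h : Literature.NumberTheory.Automorphic.Liu2021.lemD1_splitPlace_heckeEigenvalues_A) : S4ShapeA := by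
  intro F _ ι₁ μ hμ hw ℓ _ ι' Jstar t ht hτt hτt' gstar dJ hdJ hdJ0 hg hsig K₀ S hU7ₛ hLQ h4 isoₛ r ε hadm χ hJ hJu
  exact h (F : Type) μ hμ Jstar t ht gstar dJ hdJ hdJ0 hg r ε χ hJ hJu

/-- Head with S4 supplied by the Literature FACT. -/
theorem thmD6OneCurveCUF_M_of_facts' (h1 : S1Shape) (h2 : S2primeShape) (hJ2 : J2Shape) (h3 : S3ShapeM)
    (h4 : Literature.NumberTheory.Automorphic.Liu2021.lemD1_splitPlace_heckeEigenvalues_A) : thmD6OneCurveCUF :=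
  thmD6OneCurveCUF_M_of_facts h1 h2 hJ2 h3 (s4ShapeA_of_lemD1A h4)

end Summit.HodgeConjecture.CorCM.Lines.A3Liu418

/-! ## Part H — BY-PASTE of the Summits-side FACT draft `CorCM/HypLiu418/A3Liu418CorD9CongruenceRelation.lean` (placement (β),
A-plan2 (g11) 21:11:18Z; HOME draft `A-provers/A-p15/g10/A3Liu418CorD9CongruenceRelation.draft.A-p15g10.lean`) and its instantiation. -/

namespace Summit.HodgeConjecture.CorCM.Lines.A3Liu418

/-! **`complexConj_mul_complexConj_GS` — NOT RESTATED IN THE ★ RE-HOME (gate `dedup.landed`, A-p14 (g39) dry-run 2026-09-02T08:10:53Z):** the Lines original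
restates, statement for statement, the already-landed ★ `Literature.NumberTheory.Automorphic.Liu2021.Def411WeilCarriers.complexConj_mul_complexConj'` (in the import closure, `LemD1SplitPlaceHeckeEigenvaluesJunction`);
the ★ re-home uses that declaration BY NAME at every former call site of `complexConj_mul_complexConj_GS`. -/

/-- **`corD9_congruenceRelation_GS_M` — [Liu2021, Cor. D.9] for the GS curve tower in WORLD M (Hecke side at the conjugate place `c • w`), on `ω⋆`-Hom-values,
arithmetic-inverse form, `∀ K` before `∃ S₀`**
(dictionary of the Hecke/Galois directions: module docstring of the draft file `A3Liu418CorD9CongruenceRelation`)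
(NAMED FACT, D-0014: the printed corollary, not proved here; module docstring for print, dictionary, conventions).
(print: Liu2021, App. D Cor. D.9 (l. 5579–5584); Prop. D.8; Thm. D.6 (1) proof l. 5619–5624) (print: Carayol1986, §10.3) (print: GetzHahn2024, Prop. 2.3.1) -/
def corD9_congruenceRelation_GS_M : Prop :=
  ∀ (F : CMField) [IsGalois ℚ F] (ι₁ : F →+* ℂ)
    (μ : Literature.NumberTheory.Automorphic.IdeleClassGroup (F : Type) →ₜ* Circle)
    (hμ : IdeleClassGroup.IsConjugateSymplectic (F : Type) μ)
    (_hw : IdeleClassGroup.HasWeight (F : Type) μ 1)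
    (ℓ : ℕ) [Fact ℓ.Prime] (ι' : ℂ ≃+* AlgebraicClosure ℚ_[ℓ])
    (Jstar : Matrix (Fin 2) (Fin 2) (F : Type)) (t : (F : Type)) (ht : t ≠ 0) (_hτt : 0 < (ι₁ t).re) (_hτt' : (ι₁ t).im = 0)
    (gstar : GL (Fin 2) (F : Type))
    (dJ : Fin 2 → (F : Type)) (hdJ : ∀ i, IsCMField.complexConj (F : Type) (dJ i) = dJ i) (hdJ0 : ∀ i, dJ i ≠ 0)
    (hg : formCongr ((IsCMField.complexConj (F : Type) : (F : Type) ≃ₐ[↥(maximalRealSubfield (F : Type))] (F : Type)) :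
        (F : Type) →+* (F : Type)) gstar (t • Jstar) = Matrix.diagonal dJ)
    (_hsig : (∃ Tstar : GL (Fin 2) ℂ,
        formCongr (starRingEnd ℂ) Tstar ((Matrix.diagonal dJ).map ι₁) = Matrix.diagonal ![(1 : ℂ), -1]) ∧
      ∀ τ' : (F : Type) →+* ℂ, InfinitePlace.mk τ' ≠ InfinitePlace.mk ι₁ → ((Matrix.diagonal dJ).map τ').PosDef)
    (K₀ : C5.OpenCompactSubgroup ↥(finAdelic ↥(maximalRealSubfield (F : Type)) (F : Type) (IsCMField.complexConj (F : Type)) 2 Jstar))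
    (S : RecordSystemGS (F : Type) Jstar ι₁ K₀) (hU7ₛ : S.HeckeTranslateDefinedOver) (hLQ : S.IsLevelQuotient)
    (h4 : 4 ≤ Module.finrank ℚ (F : Type)) (isoₛ : ℕ → Prop)
    (r : Rep ↥(maximalRealSubfield (F : Type)) (imagUnitSq F))
    (ε : Eps ↥(maximalRealSubfield (F : Type)) (imagUnitSq F))
    (_hadm : ∃ e : (F : Type), IsAdmissibleElement (F : Type) hμ.cmType.1 e ∧
      epsOf ↥(maximalRealSubfield (F : Type)) (imagUnitSq F) (F : Type) (2 * imagUnit (F : Type))⁻¹ (-e) = ε)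
    (χ : Chi ↥(maximalRealSubfield (F : Type)) (F : Type) (IsCMField.complexConj (F : Type))),
    ∀ (hJ : (Jstar.map (IsCMField.complexConj (F : Type)))ᵀ = Jstar) (hJu : IsUnit Jstar) (K : C5.SmallLevel K₀),
    ∃ S₀ : Set (HeightOneSpectrum (𝓞 (F : Type))), S₀.Finite ∧
      ∀ w : HeightOneSpectrum (𝓞 (F : Type)), w ∉ S₀ → ∀ hw : (IsCMField.complexConj (F : Type)) • w ≠ w,
        ∀ hw' : (IsCMField.complexConj (F : Type)) • ((IsCMField.complexConj (F : Type)) • w) ≠ ((IsCMField.complexConj (F : Type)) • w),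
        (UnitaryGroup.isUnit_placeForm Jstar hJu ((IsCMField.complexConj (F : Type)) • w)).unit ∈ glInt 2 (((IsCMField.complexConj (F : Type)) • w).adicCompletion (F : Type)) →
            UnitaryGroup.IsHyperspecialAt ↥(maximalRealSubfield (F : Type)) (F : Type) (IsCMField.complexConj (F : Type)) 2 Jstar K.1.1 (((IsCMField.complexConj (F : Type)) • w).under (𝓞 ↥(maximalRealSubfield (F : Type)))) →
            ∀ 𝔓 ∈ w.primesAbove, ∀ σ : Field.absoluteGaloisGroup (F : Type), IsArithFrobAt (𝓞 (F : Type)) σ 𝔓 →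
            ∀ f' ∈ (etaleHeckeDatumGS S hU7ₛ hLQ h4 isoₛ ℓ).omegaHom ι'
                ((rhoVAtLine ↥(maximalRealSubfield (F : Type)) (F : Type) (IsCMField.complexConj (F : Type)) 2
          (finProdFinEquiv : Fin 2 × Fin 1 ≃ Fin (2 * 1)) (Matrix.diagonal dJ)
          (complexConj_imagUnit F) (imagUnit_ne_zero F) (imagUnit_mul_self F) (realDiagonal_isSymm F dJ hdJ)
          (isUnit_det_realDiagonal F dJ hdJ hdJ0) (realDiagonal_map F dJ hdJ).symm
          (hsChiGS F finProdFinEquiv dJ hdJ hdJ0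
            (toHeckeCharacter (F : Type) (galConj (IsCMField.complexConj (F : Type)) μ))
            (isUnitary_toHeckeCharacter (F : Type) (galConj (IsCMField.complexConj (F : Type)) μ))
            ((isOscillatorChar_toHeckeCharacter_iff (galConj (IsCMField.complexConj (F : Type)) μ)).mpr hμ.galConj))
          (r.toFun ε) χ).comp
          (finAdelicCongr ↥(maximalRealSubfield (F : Type)) (F : Type) (IsCMField.complexConj (F : Type)) gstar ht hg).symm.toMonoidHom),
            ∀ x ∈ Representation.fixedPoints
                ((rhoVAtLine ↥(maximalRealSubfield (F : Type)) (F : Type) (IsCMField.complexConj (F : Type)) 2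
          (finProdFinEquiv : Fin 2 × Fin 1 ≃ Fin (2 * 1)) (Matrix.diagonal dJ)
          (complexConj_imagUnit F) (imagUnit_ne_zero F) (imagUnit_mul_self F) (realDiagonal_isSymm F dJ hdJ)
          (isUnit_det_realDiagonal F dJ hdJ hdJ0) (realDiagonal_map F dJ hdJ).symm
          (hsChiGS F finProdFinEquiv dJ hdJ hdJ0
            (toHeckeCharacter (F : Type) (galConj (IsCMField.complexConj (F : Type)) μ))
            (isUnitary_toHeckeCharacter (F : Type) (galConj (IsCMField.complexConj (F : Type)) μ))
            ((isOscillatorChar_toHeckeCharacter_iff (galConj (IsCMField.complexConj (F : Type)) μ)).mpr hμ.galConj))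
          (r.toFun ε) χ).comp
          (finAdelicCongr ↥(maximalRealSubfield (F : Type)) (F : Type) (IsCMField.complexConj (F : Type)) gstar ht hg).symm.toMonoidHom) K.1.1,
              (Ideal.absNorm w.asIdeal : AlgebraicClosure ℚ_[ℓ]) •
                  ((sec42DataGS S h4 isoₛ).towerRep ℓ σ).baseChange (AlgebraicClosure ℚ_[ℓ])
                    (((sec42DataGS S h4 isoₛ).towerRep ℓ σ).baseChange (AlgebraicClosure ℚ_[ℓ])
                      (f' (UnitaryGroup.heckeTAt ↥(maximalRealSubfield (F : Type)) (F : Type) (IsCMField.complexConj (F : Type)) 2 Jstar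
                        ((rhoVAtLine ↥(maximalRealSubfield (F : Type)) (F : Type) (IsCMField.complexConj (F : Type)) 2
          (finProdFinEquiv : Fin 2 × Fin 1 ≃ Fin (2 * 1)) (Matrix.diagonal dJ)
          (complexConj_imagUnit F) (imagUnit_ne_zero F) (imagUnit_mul_self F) (realDiagonal_isSymm F dJ hdJ)
          (isUnit_det_realDiagonal F dJ hdJ hdJ0) (realDiagonal_map F dJ hdJ).symm
          (hsChiGS F finProdFinEquiv dJ hdJ hdJ0
            (toHeckeCharacter (F : Type) (galConj (IsCMField.complexConj (F : Type)) μ))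
            (isUnitary_toHeckeCharacter (F : Type) (galConj (IsCMField.complexConj (F : Type)) μ))
            ((isOscillatorChar_toHeckeCharacter_iff (galConj (IsCMField.complexConj (F : Type)) μ)).mpr hμ.galConj))
          (r.toFun ε) χ).comp
          (finAdelicCongr ↥(maximalRealSubfield (F : Type)) (F : Type) (IsCMField.complexConj (F : Type)) gstar ht hg).symm.toMonoidHom)
                        K.1.1 (⟨((IsCMField.complexConj (F : Type)) • w), rfl⟩ : UnitaryGroup.PlacesOver (F : Type) (((IsCMField.complexConj (F : Type)) • w).under (𝓞 ↥(maximalRealSubfield (F : Type)))))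
                        (IsCMField.complexConj_ne_one (F : Type)) hJ hw' (UnitaryGroup.isUnit_placeForm Jstar hJu ((IsCMField.complexConj (F : Type)) • w)) (HeckeCharacter.uniformizer (F : Type) ((IsCMField.complexConj (F : Type)) • w)) 2 x))) -
                ((sec42DataGS S h4 isoₛ).towerRep ℓ σ).baseChange (AlgebraicClosure ℚ_[ℓ])
                  (f' (UnitaryGroup.heckeTAt ↥(maximalRealSubfield (F : Type)) (F : Type) (IsCMField.complexConj (F : Type)) 2 Jstar
                    ((rhoVAtLine ↥(maximalRealSubfield (F : Type)) (F : Type) (IsCMField.complexConj (F : Type)) 2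
          (finProdFinEquiv : Fin 2 × Fin 1 ≃ Fin (2 * 1)) (Matrix.diagonal dJ)
          (complexConj_imagUnit F) (imagUnit_ne_zero F) (imagUnit_mul_self F) (realDiagonal_isSymm F dJ hdJ)
          (isUnit_det_realDiagonal F dJ hdJ hdJ0) (realDiagonal_map F dJ hdJ).symm
          (hsChiGS F finProdFinEquiv dJ hdJ hdJ0
            (toHeckeCharacter (F : Type) (galConj (IsCMField.complexConj (F : Type)) μ))
            (isUnitary_toHeckeCharacter (F : Type) (galConj (IsCMField.complexConj (F : Type)) μ))
            ((isOscillatorChar_toHeckeCharacter_iff (galConj (IsCMField.complexConj (F : Type)) μ)).mpr hμ.galConj))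
          (r.toFun ε) χ).comp
          (finAdelicCongr ↥(maximalRealSubfield (F : Type)) (F : Type) (IsCMField.complexConj (F : Type)) gstar ht hg).symm.toMonoidHom)
                    K.1.1 (⟨((IsCMField.complexConj (F : Type)) • w), rfl⟩ : UnitaryGroup.PlacesOver (F : Type) (((IsCMField.complexConj (F : Type)) • w).under (𝓞 ↥(maximalRealSubfield (F : Type)))))
                    (IsCMField.complexConj_ne_one (F : Type)) hJ hw' (UnitaryGroup.isUnit_placeForm Jstar hJu ((IsCMField.complexConj (F : Type)) • w)) (HeckeCharacter.uniformizer (F : Type) ((IsCMField.complexConj (F : Type)) • w)) 1 x)) +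
                f' x = 0


/-- **`S3ShapeM` ⇐ the named fact [Liu2021, Cor. D.9] for the GS tower** (same text; one application). -/
theorem s3ShapeM_of_corD9M (h : corD9_congruenceRelation_GS_M) : S3ShapeM := by
  intro F _ ι₁ μ hμ hw ℓ _ ι' Jstar t ht hτt hτt' gstar dJ hdJ hdJ0 hg hsig K₀ S hU7ₛ hLQ h4 isoₛ r ε hadm χ hJ hJu K
  exact h F ι₁ μ hμ hw ℓ ι' Jstar t ht hτt hτt' gstar dJ hdJ hdJ0 hg hsig K₀ S hU7ₛ hLQ h4 isoₛ r ε hadm χ hJ hJu K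

/-- Head with S3 AND S4 supplied by the two named facts of record (drafts): the non-FACT inputs are exactly S1 (1), S2′, (J2). -/
theorem thmD6OneCurveCUF_M_of_facts'' (h1 : S1Shape) (h2 : S2primeShape) (hJ2 : J2Shape) (h3 : corD9_congruenceRelation_GS_M)
    (h4 : Literature.NumberTheory.Automorphic.Liu2021.lemD1_splitPlace_heckeEigenvalues_A) : thmD6OneCurveCUF :=
  thmD6OneCurveCUF_M_of_facts h1 h2 hJ2 (s3ShapeM_of_corD9M h3) (s4ShapeA_of_lemD1A h4)

end Summit.HodgeConjecture.CorCM.Lines.A3Liu418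

/-! ## Part I — S1 clause (2) as an intrinsic Betti shape and the DERIVATION of the (J2) orientation token -/

namespace Summit.HodgeConjecture.CorCM.Lines.A3Liu418

open CategoryTheory D6Glue
open Literature.AlgebraicGeometry.Motives (AbelianVariety)

/-- **`S1bShape`** — S1 clause (2) [Liu2021, Prop. D.4 (1) / Rem. D.5] read on the CM quotient, INTRINSIC phrasing (A-plan2 (g11)
21:13:32Z, REF1 (g10) m06 (R7)): for the S2′ data (a `τ`-eigen class whose transport is a non-zero element of the span of the `ω⋆_lab`-block)
and every CM-type realisation `(B′, ρ, Φ; θ)` of the quotient at `ι₁`, SOME non-zero `τ`-eigenvector of `H¹(B′ ×_{F,ι₁} ℂ; ℂ)` is of Hodge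
type `(1,0)` if `ι₁ ∈ Φ_μ` (`hμ.cmType`) and of type `(0,1)` otherwise — «the block is holomorphic at `ι₁` iff `ι₁ ∈ Φ_μ`» (print:
`m_cusp(π_∞^{(1,0)} ⊗ π^∞) = 1` iff `ε` is `μ`-admissible, with `τ′₁ ∈ Φ_μ`; the tree carries no `ι₁ ∈ Φ_μ` binder, both branches occur). -/
def S1bShape : Prop :=
  ∀ (F : CMField) [IsGalois ℚ F] (ι₁ : F →+* ℂ)
    (μ : Literature.NumberTheory.Automorphic.IdeleClassGroup (F : Type) →ₜ* Circle)
    (hμ : IdeleClassGroup.IsConjugateSymplectic (F : Type) μ)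
    (_hw : IdeleClassGroup.HasWeight (F : Type) μ 1)
    (ℓ : ℕ) [Fact ℓ.Prime] (ι' : ℂ ≃+* AlgebraicClosure ℚ_[ℓ])
    (Jstar : Matrix (Fin 2) (Fin 2) (F : Type)) (t : (F : Type)) (ht : t ≠ 0) (_hτt : 0 < (ι₁ t).re) (_hτt' : (ι₁ t).im = 0)
    (gstar : GL (Fin 2) (F : Type))
    (dJ : Fin 2 → (F : Type)) (hdJ : ∀ i, IsCMField.complexConj (F : Type) (dJ i) = dJ i) (hdJ0 : ∀ i, dJ i ≠ 0)
    (hg : formCongr ((IsCMField.complexConj (F : Type) : (F : Type) ≃ₐ[↥(maximalRealSubfield (F : Type))] (F : Type)) :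
        (F : Type) →+* (F : Type)) gstar (t • Jstar) = Matrix.diagonal dJ)
    (_hsig : (∃ Tstar : GL (Fin 2) ℂ,
        formCongr (starRingEnd ℂ) Tstar ((Matrix.diagonal dJ).map ι₁) = Matrix.diagonal ![(1 : ℂ), -1]) ∧
      ∀ τ' : (F : Type) →+* ℂ, InfinitePlace.mk τ' ≠ InfinitePlace.mk ι₁ → ((Matrix.diagonal dJ).map τ').PosDef)
    (K₀ : C5.OpenCompactSubgroup ↥(finAdelic ↥(maximalRealSubfield (F : Type)) (F : Type) (IsCMField.complexConj (F : Type)) 2 Jstar))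
    (S : RecordSystemGS (F : Type) Jstar ι₁ K₀) (hU7ₛ : S.HeckeTranslateDefinedOver) (hLQ : S.IsLevelQuotient)
    (h4 : 4 ≤ Module.finrank ℚ (F : Type)) (isoₛ : ℕ → Prop)
    (r : Rep ↥(maximalRealSubfield (F : Type)) (imagUnitSq F))
    (ε : Eps ↥(maximalRealSubfield (F : Type)) (imagUnitSq F))
    (_hadm : ∃ e : (F : Type), IsAdmissibleElement (F : Type) hμ.cmType.1 e ∧
      epsOf ↥(maximalRealSubfield (F : Type)) (imagUnitSq F) (F : Type) (2 * imagUnit (F : Type))⁻¹ (-e) = ε)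
    (χ : Chi ↥(maximalRealSubfield (F : Type)) (F : Type) (IsCMField.complexConj (F : Type))),
    letI : Algebra (F : Type) ℂ := ι₁.toAlgebra
    ∀ (K : C5.SmallLevel K₀) {B : Literature.AlgebraicGeometry.Motives.AbelianVariety (F : Type)} (φ : (sec42DataGS S h4 isoₛ).A K ⟶ B)
      (M : Type) [Field M] [NumberField M] [IsCMField M] (i : M →+* B.endAlgebra),
      Module.finrank ℚ M = 2 * B.dim →
      ∀ (τ : M →+* ℂ) (f : (AlgebraicClosure ℚ_[ℓ]) ⊗[ℚ_[ℓ]] Module.Dual ℚ_[ℓ] (B.rationalTateModule ℓ)),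
        (∀ m : M, ((AbelianVariety.rationalTateAction B ℓ (i m)).dualMap).baseChange (AlgebraicClosure ℚ_[ℓ]) f = ι' (τ m) • f) →
        (((sec42DataGS S h4 isoₛ).toTower ℓ K ∘ₗ (AbelianVariety.rationalTateModuleMap ℓ φ).dualMap).baseChange (AlgebraicClosure ℚ_[ℓ])) f ≠ 0 →
        (((sec42DataGS S h4 isoₛ).toTower ℓ K ∘ₗ (AbelianVariety.rationalTateModuleMap ℓ φ).dualMap).baseChange (AlgebraicClosure ℚ_[ℓ])) f ∈
          Submodule.span (AlgebraicClosure ℚ_[ℓ]) (blockValues (sec42DataGS S h4 isoₛ) ℓ (etaleHeckeDatumGS S hU7ₛ hLQ h4 isoₛ ℓ) ι'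
            ((rhoVAtLine ↥(maximalRealSubfield (F : Type)) (F : Type) (IsCMField.complexConj (F : Type)) 2
          (finProdFinEquiv : Fin 2 × Fin 1 ≃ Fin (2 * 1)) (Matrix.diagonal dJ)
          (complexConj_imagUnit F) (imagUnit_ne_zero F) (imagUnit_mul_self F) (realDiagonal_isSymm F dJ hdJ)
          (isUnit_det_realDiagonal F dJ hdJ hdJ0) (realDiagonal_map F dJ hdJ).symm
          (hsChiGS F finProdFinEquiv dJ hdJ hdJ0
            (toHeckeCharacter (F : Type) (galConj (IsCMField.complexConj (F : Type)) μ))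
            (isUnitary_toHeckeCharacter (F : Type) (galConj (IsCMField.complexConj (F : Type)) μ))
            ((isOscillatorChar_toHeckeCharacter_iff (galConj (IsCMField.complexConj (F : Type)) μ)).mpr hμ.galConj))
          (r.toFun ε) χ).comp
          (finAdelicCongr ↥(maximalRealSubfield (F : Type)) (F : Type) (IsCMField.complexConj (F : Type)) gstar ht hg).symm.toMonoidHom)) →
        ∀ (B' : Literature.AlgebraicGeometry.Motives.AbelianVariety (F : Type)) (u' : B ⟶ B') (v' : B' ⟶ B) (m : ℕ) (hm : 0 < m)
          (huv : u' ≫ v' = m • 𝟙 B) (hvu : v' ≫ u' = m • 𝟙 B') (ρ : 𝓞 M →+* End B')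
          (Φ : Literature.AlgebraicGeometry.Motives.CMType M),
          AbelianVariety.IsIsogeny u' →
          (∀ a : 𝓞 M, AbelianVariety.endAlgebraTransport u' v' m hm huv hvu (i (a : M)) = AbelianVariety.endAlgebra.of B' (ρ a)) →
          ∀ (θ : M →+* Module.End ℂ (Literature.AlgebraicGeometry.HodgeTheory.complexBetti (B'.baseChange ℂ).X 1)),
            Literature.AlgebraicGeometry.ComplexMultiplication.IsCMTypeRealisation Φ (B'.baseChange ℂ) ((B'.endBaseChange ℂ).comp ρ) θ →
            ∃ v ∈ Literature.NumberTheory.Automorphic.PicardCM.eigenline θ τ, v ≠ 0 ∧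
              (ι₁ ∈ hμ.cmType.1 →
                Literature.AlgebraicGeometry.HodgeTheory.IsOfHodgeType (Module.finrank ℚ M / 2) (B'.baseChange ℂ).X 1 1 0 v) ∧
              (ι₁ ∉ hμ.cmType.1 →
                Literature.AlgebraicGeometry.HodgeTheory.IsOfHodgeType (Module.finrank ℚ M / 2) (B'.baseChange ℂ).X 1 0 1 v)

/-- **`J2Shape` ⇐ `S1bShape`** — the orientation token DERIVED: case split on `(mk ι₁).embedding = ι₁ ∨ = ι̅₁` (Mathlib
`embedding_mk_eq`) × `ι₁ ∈ Φ_μ` or not; ★ A-p11 (g11) `IsCMTypeRealisation.cmInfinityType_fst_eq_of_isOfHodgeType(_conjugate)` reads the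
first exponent of `χ_τ` as the Hodge index, ★ `exponentAt_embedding`/`exponentAt_conjugate_embedding` + `mem_cmTypeOf_iff` + weight one
(`|e(mk ι₁)| = 1`) read `(1 − e(mk ι₁))/2` the same way. -/
theorem j2Shape_of_S1b (h : S1bShape) : J2Shape := by
  intro F _ ι₁ μ hμ hw ℓ _ ι' Jstar t ht hτt hτt' gstar dJ hdJ hdJ0 hg hsig K₀ S hU7ₛ hLQ h4 isoₛ r ε hadm χ K B
    φ M _ _ _ i hdim τ f heig hy0 hyspan B' u' v' m hm huv hvu ρ Φ hisog hcompat hreal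
  classical
  letI : Algebra (F : Type) ℂ := ι₁.toAlgebra
  -- the reflex inclusion `K*(Φ) ⊆ ι₁(F)` ([Shimura1998] §8.5 Prop. 30): ★ `IsCMTypeRealisationOver.traceField_le_fieldRange`
  have hk : (Literature.NumberTheory.ComplexMultiplication.traceField Φ).toSubfield ≤ ι₁.fieldRange :=
    hreal.traceField_le_fieldRange
  obtain ⟨θ, hθ⟩ := hreal
  obtain ⟨v, hv, hv0, h10, h01⟩ := h F ι₁ μ hμ hw ℓ ι' Jstar t ht hτt hτt' gstar dJ hdJ hdJ0 hg hsig K₀ S hU7ₛ hLQ h4 isoₛ r ε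
    hadm χ K φ M i hdim τ f heig hy0 hyspan B' u' v' m hm huv hvu ρ Φ hisog hcompat θ hθ
  have hab : Literature.AlgebraicGeometry.HodgeTheory.IsOfHodgeType (Module.finrank ℚ M / 2) (B'.baseChange ℂ).X 1
      (if ι₁ ∈ hμ.cmType.1 then 1 else 0) (if ι₁ ∈ hμ.cmType.1 then 0 else 1) v := by
    by_cases hP : ι₁ ∈ hμ.cmType.1
    · rw [if_pos hP, if_pos hP]; exact h10 hP
    · rw [if_neg hP, if_neg hP]; exact h01 hP
  -- ★ A-p11 (g11) `CMInfinityTypeExponentIntrinsic`: the orientation token from the Hodge type of the `τ`-eigenline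
  exact hθ.cmInfinityType_fst_mk_eq_half_one_sub (σ₀ := ι₁) hk hμ hw hv hv0 hab

/-- **THE HEAD WITH (J2) DERIVED (WORLD M)**: the REGISTERED `thmD6OneCurveCUF` from S1 (1) (`S1Shape`), S1 (2) (`S1bShape`), S2′, S3, S4 — all five are
printed-fact / printed-theorem texts; the orientation is computed in the kernel. -/
theorem thmD6OneCurveCUF_M_of_facts_v9 (h1a : S1Shape) (h1b : S1bShape) (h2 : S2primeShape) (h3 : S3ShapeM) (h4 : S4ShapeA) :
    thmD6OneCurveCUF :=
  thmD6OneCurveCUF_M_of_facts h1a h2 (j2Shape_of_S1b h1b) h3 h4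

end Summit.HodgeConjecture.CorCM.Lines.A3Liu418

/-! ## Part J — S1 clause (3) «the level-`K` Hecke module `H¹_ét(A_K)` is semisimple», ÉTALE phrasing (A-plan2 (g11) 21:40:42Z on A-p09 (g13)'s census;
NOT consumed by the composition — it is an input of the S2′ builder's DH2b) -/

namespace Summit.HodgeConjecture.CorCM.Lines.A3Liu418

/-- **`S1cShape`** — S1 clause (3) [Liu2021, p. 133 (D.3)]: for every sufficiently small level `K`, `H¹_ét(A_K, ℚ_ℓ)` is a SEMISIMPLE module over the
`ℚ_ℓ`-algebra generated by the Hecke endomorphisms `[KgK]` (★ DH1 `Sec42Data.HeckeTranslates.heckeEnd`, read on `H¹_ét = V_ℓ^∨` through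
★ `AbelianVariety.rationalTateAction` and the transpose) at the registered GS datum. -/
def S1cShape : Prop :=
  ∀ (F : CMField) [IsGalois ℚ F] (ι₁ : F →+* ℂ)
    (μ : Literature.NumberTheory.Automorphic.IdeleClassGroup (F : Type) →ₜ* Circle)
    (hμ : IdeleClassGroup.IsConjugateSymplectic (F : Type) μ)
    (_hw : IdeleClassGroup.HasWeight (F : Type) μ 1)
    (ℓ : ℕ) [Fact ℓ.Prime] (ι' : ℂ ≃+* AlgebraicClosure ℚ_[ℓ])
    (Jstar : Matrix (Fin 2) (Fin 2) (F : Type)) (t : (F : Type)) (ht : t ≠ 0) (_hτt : 0 < (ι₁ t).re) (_hτt' : (ι₁ t).im = 0)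
    (gstar : GL (Fin 2) (F : Type))
    (dJ : Fin 2 → (F : Type)) (hdJ : ∀ i, IsCMField.complexConj (F : Type) (dJ i) = dJ i) (hdJ0 : ∀ i, dJ i ≠ 0)
    (hg : formCongr ((IsCMField.complexConj (F : Type) : (F : Type) ≃ₐ[↥(maximalRealSubfield (F : Type))] (F : Type)) :
        (F : Type) →+* (F : Type)) gstar (t • Jstar) = Matrix.diagonal dJ)
    (_hsig : (∃ Tstar : GL (Fin 2) ℂ,
        formCongr (starRingEnd ℂ) Tstar ((Matrix.diagonal dJ).map ι₁) = Matrix.diagonal ![(1 : ℂ), -1]) ∧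
      ∀ τ' : (F : Type) →+* ℂ, InfinitePlace.mk τ' ≠ InfinitePlace.mk ι₁ → ((Matrix.diagonal dJ).map τ').PosDef)
    (K₀ : C5.OpenCompactSubgroup ↥(finAdelic ↥(maximalRealSubfield (F : Type)) (F : Type) (IsCMField.complexConj (F : Type)) 2 Jstar))
    (S : RecordSystemGS (F : Type) Jstar ι₁ K₀) (hU7ₛ : S.HeckeTranslateDefinedOver) (hLQ : S.IsLevelQuotient)
    (h4 : 4 ≤ Module.finrank ℚ (F : Type)) (isoₛ : ℕ → Prop)
    (r : Rep ↥(maximalRealSubfield (F : Type)) (imagUnitSq F))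
    (ε : Eps ↥(maximalRealSubfield (F : Type)) (imagUnitSq F))
    (_hadm : ∃ e : (F : Type), IsAdmissibleElement (F : Type) hμ.cmType.1 e ∧
      epsOf ↥(maximalRealSubfield (F : Type)) (imagUnitSq F) (F : Type) (2 * imagUnit (F : Type))⁻¹ (-e) = ε)
    (χ : Chi ↥(maximalRealSubfield (F : Type)) (F : Type) (IsCMField.complexConj (F : Type))),
    ∀ K : C5.SmallLevel K₀,
      IsSemisimpleModule
        ↥(Algebra.adjoin ℚ_[ℓ] (Set.range fun g : ↥(finAdelic ↥(maximalRealSubfield (F : Type)) (F : Type) (IsCMField.complexConj (F : Type)) 2 Jstar) =>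
            (Literature.AlgebraicGeometry.Motives.AbelianVariety.rationalTateAction ((sec42DataGS S h4 isoₛ).A K) ℓ
              ((sec42HeckeTranslatesGS S hU7ₛ h4 isoₛ).heckeEnd (isogenyDescent_GS S hU7ₛ hLQ h4 isoₛ) K g)).dualMap))
        ((sec42DataGS S h4 isoₛ).etaleH1 ℓ K)

end Summit.HodgeConjecture.CorCM.Lines.A3Liu418
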